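import Summits.CriticalPhenomena.PercolationContinuityZ3.Theorems.PercNearOneGluingNoHeavyQuantThreePortNearHalf
import HarnessLib

/-!
# The three-port residual kit: all three Gladkov–Zimin rows off the observer, and `Z(3,2)` from any real-algebra cell solver

builds on p205010 (kernel theorem, internal audit signed; external expert review pending)

Support file (`--supports stmt-CriticalPhenomena-4575`), seat `prim-quant-p1` (gen 4); memo `run/shared/lean/prim/quant/P1-SURPLUS.md` §14.7.
No definitions, no named facts, no sorries; standard axioms.

At a THREE-PORT observer `o` (hairs `α, β, γ` to `a, b, c`, arbitrary finite graph off `o`) every quantity of `Z(3,2)` is a function of the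
hairs and the five off-`o` cells `U0, Uab, Uac, Ubc, U3` (`a`-dictionary of `ThreePort`): marginals (`real_openConn`), apex margins
(`margin_eq`), and the cells satisfy `Σ = 1` (`cells_sum_eq_one`) and Gladkov–Zimin at each apex.  This file makes the reduction
'`Z(3,2)` at three-port observers ⟸ a real inequality in 3 + 5 variables' a single theorem:

* `ThreePort.gz_offObserver_apex_b`, `ThreePort.gz_offObserver_apex_c` — the GZ rows at the other two apexes, in the `a`-dictionary:
  `(U0 + Uac)(Uab + Ubc + U3) ≤ Uab + Uac + Ubc` and `(U0 + Uab)(Uac + Ubc + U3) ≤ Uab + Uac + Ubc` (from `gz_offObserver` by relabelling;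
  reachability is an equivalence relation).
* `ThreePort.le_one_reached_le_of_cellSolver` — if a real-algebra 'cell solver' refutes, for the given hairs, the system
  {cells `≥ 0`, `Σ cells = 1`, the three failed exchanges `U0·T_v + U_opp(v)·V_v < 0`, the three GZ rows, `Σ_v q_v > 2` in collected
  cell form (`sigma_cells_collect`)}, then `Z(3,2)` holds at `o`: `Σ_v μ(o↔v) > 2`, `t ≥ μ(o↮v)` ⟹ `μ{N ≤ 1} ≤ t`.
  `le_one_reached_le_of_nearHalf_hairs` (p219549) is the instance 'hairs in `[9/20, ½]`' with solver `nearHalf_residual_false` (which uses only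
  the `a`-apex GZ row); the abstract optimum with all three rows stays `< 2` on a much larger balanced hair region (memo §14.7) — every
  further region is now a pure real-algebra lemma away.
[cite: GladkovZimin2024, Thm. 4.6]; [cite: KozmaNitzan2024, Lemma 2 (p. 6)] (context).
-/

noncomputable section

namespace Summit.CriticalPhenomena.PercolationContinuityZ3.Theorems

open MeasureTheory Set Literature.Probability.LatticeModels Literature.Probability.Percolation
open scoped Classical BigOperators

variable {n : ℕ}

namespace ThreePort

/-! ### The GZ rows at the apexes `b` and `c`, in the `a`-dictionary -/

section GZ

variable (w : Sym2 (Fin n) → unitInterval) (o a b c : Fin n)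

/-- Gladkov–Zimin off `o` at apex `b`: `(U0 + Uac)·(Uab + Ubc + U3) ≤ Uab + Uac + Ubc`. [cite: GladkovZimin2024, Thm. 4.6] -/
theorem gz_offObserver_apex_b :
    ((prodBernoulli w).real {ω | ¬ (openGraph (ω ∩ {e | o ∉ e})).Reachable a b ∧
        ¬ (openGraph (ω ∩ {e | o ∉ e})).Reachable a c ∧ ¬ (openGraph (ω ∩ {e | o ∉ e})).Reachable b c} +
      (prodBernoulli w).real {ω | (openGraph (ω ∩ {e | o ∉ e})).Reachable a c ∧
        ¬ (openGraph (ω ∩ {e | o ∉ e})).Reachable a b}) *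
      ((prodBernoulli w).real {ω | (openGraph (ω ∩ {e | o ∉ e})).Reachable a b ∧
          ¬ (openGraph (ω ∩ {e | o ∉ e})).Reachable a c} +
        (prodBernoulli w).real {ω | (openGraph (ω ∩ {e | o ∉ e})).Reachable b c ∧
          ¬ (openGraph (ω ∩ {e | o ∉ e})).Reachable a b} +
        (prodBernoulli w).real {ω | (openGraph (ω ∩ {e | o ∉ e})).Reachable a b ∧
          (openGraph (ω ∩ {e | o ∉ e})).Reachable a c}) ≤
      (prodBernoulli w).real {ω | (openGraph (ω ∩ {e | o ∉ e})).Reachable a b ∧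
          ¬ (openGraph (ω ∩ {e | o ∉ e})).Reachable a c} +
        (prodBernoulli w).real {ω | (openGraph (ω ∩ {e | o ∉ e})).Reachable a c ∧
          ¬ (openGraph (ω ∩ {e | o ∉ e})).Reachable a b} +
        (prodBernoulli w).real {ω | (openGraph (ω ∩ {e | o ∉ e})).Reachable b c ∧
          ¬ (openGraph (ω ∩ {e | o ∉ e})).Reachable a b} := by
  have h := gz_offObserver w o b a c
  have s1 : {ω : BondConfig (Fin n) | ¬ (openGraph (ω ∩ {e | o ∉ e})).Reachable b a ∧
      ¬ (openGraph (ω ∩ {e | o ∉ e})).Reachable b c ∧ ¬ (openGraph (ω ∩ {e | o ∉ e})).Reachable a c} =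
      {ω | ¬ (openGraph (ω ∩ {e | o ∉ e})).Reachable a b ∧
        ¬ (openGraph (ω ∩ {e | o ∉ e})).Reachable a c ∧ ¬ (openGraph (ω ∩ {e | o ∉ e})).Reachable b c} := by
    ext ω; simp only [Set.mem_setOf_eq]
    exact ⟨fun ⟨h1, h2, h3⟩ => ⟨fun h => h1 h.symm, h3, h2⟩, fun ⟨h1, h2, h3⟩ => ⟨fun h => h1 h.symm, h3, h2⟩⟩
  have s2 : {ω : BondConfig (Fin n) | (openGraph (ω ∩ {e | o ∉ e})).Reachable a c ∧
      ¬ (openGraph (ω ∩ {e | o ∉ e})).Reachable b a} =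
      {ω | (openGraph (ω ∩ {e | o ∉ e})).Reachable a c ∧ ¬ (openGraph (ω ∩ {e | o ∉ e})).Reachable a b} := by
    ext ω; simp only [Set.mem_setOf_eq]
    exact ⟨fun ⟨h1, h2⟩ => ⟨h1, fun h => h2 h.symm⟩, fun ⟨h1, h2⟩ => ⟨h1, fun h => h2 h.symm⟩⟩
  have s3 : {ω : BondConfig (Fin n) | (openGraph (ω ∩ {e | o ∉ e})).Reachable b a ∧
      ¬ (openGraph (ω ∩ {e | o ∉ e})).Reachable b c} =
      {ω | (openGraph (ω ∩ {e | o ∉ e})).Reachable a b ∧ ¬ (openGraph (ω ∩ {e | o ∉ e})).Reachable a c} := by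
    ext ω; simp only [Set.mem_setOf_eq]
    exact ⟨fun ⟨h1, h2⟩ => ⟨h1.symm, fun h => h2 (h1.trans h)⟩, fun ⟨h1, h2⟩ => ⟨h1.symm, fun h => h2 (h1.trans h)⟩⟩
  have s4 : {ω : BondConfig (Fin n) | (openGraph (ω ∩ {e | o ∉ e})).Reachable b c ∧
      ¬ (openGraph (ω ∩ {e | o ∉ e})).Reachable b a} =
      {ω | (openGraph (ω ∩ {e | o ∉ e})).Reachable b c ∧ ¬ (openGraph (ω ∩ {e | o ∉ e})).Reachable a b} := by
    ext ω; simp only [Set.mem_setOf_eq]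
    exact ⟨fun ⟨h1, h2⟩ => ⟨h1, fun h => h2 h.symm⟩, fun ⟨h1, h2⟩ => ⟨h1, fun h => h2 h.symm⟩⟩
  have s5 : {ω : BondConfig (Fin n) | (openGraph (ω ∩ {e | o ∉ e})).Reachable b a ∧
      (openGraph (ω ∩ {e | o ∉ e})).Reachable b c} =
      {ω | (openGraph (ω ∩ {e | o ∉ e})).Reachable a b ∧ (openGraph (ω ∩ {e | o ∉ e})).Reachable a c} := by
    ext ω; simp only [Set.mem_setOf_eq]
    exact ⟨fun ⟨h1, h2⟩ => ⟨h1.symm, h1.symm.trans h2⟩, fun ⟨h1, h2⟩ => ⟨h1.symm, h1.symm.trans h2⟩⟩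
  rw [s1, s2, s3, s4, s5] at h
  linarith [h]

/-- Gladkov–Zimin off `o` at apex `c`: `(U0 + Uab)·(Uac + Ubc + U3) ≤ Uab + Uac + Ubc`. [cite: GladkovZimin2024, Thm. 4.6] -/
theorem gz_offObserver_apex_c :
    ((prodBernoulli w).real {ω | ¬ (openGraph (ω ∩ {e | o ∉ e})).Reachable a b ∧
        ¬ (openGraph (ω ∩ {e | o ∉ e})).Reachable a c ∧ ¬ (openGraph (ω ∩ {e | o ∉ e})).Reachable b c} +
      (prodBernoulli w).real {ω | (openGraph (ω ∩ {e | o ∉ e})).Reachable a b ∧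
        ¬ (openGraph (ω ∩ {e | o ∉ e})).Reachable a c}) *
      ((prodBernoulli w).real {ω | (openGraph (ω ∩ {e | o ∉ e})).Reachable a c ∧
          ¬ (openGraph (ω ∩ {e | o ∉ e})).Reachable a b} +
        (prodBernoulli w).real {ω | (openGraph (ω ∩ {e | o ∉ e})).Reachable b c ∧
          ¬ (openGraph (ω ∩ {e | o ∉ e})).Reachable a b} +
        (prodBernoulli w).real {ω | (openGraph (ω ∩ {e | o ∉ e})).Reachable a b ∧
          (openGraph (ω ∩ {e | o ∉ e})).Reachable a c}) ≤
      (prodBernoulli w).real {ω | (openGraph (ω ∩ {e | o ∉ e})).Reachable a b ∧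
          ¬ (openGraph (ω ∩ {e | o ∉ e})).Reachable a c} +
        (prodBernoulli w).real {ω | (openGraph (ω ∩ {e | o ∉ e})).Reachable a c ∧
          ¬ (openGraph (ω ∩ {e | o ∉ e})).Reachable a b} +
        (prodBernoulli w).real {ω | (openGraph (ω ∩ {e | o ∉ e})).Reachable b c ∧
          ¬ (openGraph (ω ∩ {e | o ∉ e})).Reachable a b} := by
  have h := gz_offObserver w o c a b
  have s1 : {ω : BondConfig (Fin n) | ¬ (openGraph (ω ∩ {e | o ∉ e})).Reachable c a ∧
      ¬ (openGraph (ω ∩ {e | o ∉ e})).Reachable c b ∧ ¬ (openGraph (ω ∩ {e | o ∉ e})).Reachable a b} =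
      {ω | ¬ (openGraph (ω ∩ {e | o ∉ e})).Reachable a b ∧
        ¬ (openGraph (ω ∩ {e | o ∉ e})).Reachable a c ∧ ¬ (openGraph (ω ∩ {e | o ∉ e})).Reachable b c} := by
    ext ω; simp only [Set.mem_setOf_eq]
    exact ⟨fun ⟨h1, h2, h3⟩ => ⟨h3, fun h => h1 h.symm, fun h => h2 h.symm⟩,
      fun ⟨h1, h2, h3⟩ => ⟨fun h => h2 h.symm, fun h => h3 h.symm, h1⟩⟩
  have s2 : {ω : BondConfig (Fin n) | (openGraph (ω ∩ {e | o ∉ e})).Reachable a b ∧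
      ¬ (openGraph (ω ∩ {e | o ∉ e})).Reachable c a} =
      {ω | (openGraph (ω ∩ {e | o ∉ e})).Reachable a b ∧ ¬ (openGraph (ω ∩ {e | o ∉ e})).Reachable a c} := by
    ext ω; simp only [Set.mem_setOf_eq]
    exact ⟨fun ⟨h1, h2⟩ => ⟨h1, fun h => h2 h.symm⟩, fun ⟨h1, h2⟩ => ⟨h1, fun h => h2 h.symm⟩⟩
  have s3 : {ω : BondConfig (Fin n) | (openGraph (ω ∩ {e | o ∉ e})).Reachable c a ∧
      ¬ (openGraph (ω ∩ {e | o ∉ e})).Reachable c b} =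
      {ω | (openGraph (ω ∩ {e | o ∉ e})).Reachable a c ∧ ¬ (openGraph (ω ∩ {e | o ∉ e})).Reachable a b} := by
    ext ω; simp only [Set.mem_setOf_eq]
    exact ⟨fun ⟨h1, h2⟩ => ⟨h1.symm, fun h => h2 (h1.trans h)⟩, fun ⟨h1, h2⟩ => ⟨h1.symm, fun h => h2 (h1.trans h)⟩⟩
  have s4 : {ω : BondConfig (Fin n) | (openGraph (ω ∩ {e | o ∉ e})).Reachable c b ∧
      ¬ (openGraph (ω ∩ {e | o ∉ e})).Reachable c a} =
      {ω | (openGraph (ω ∩ {e | o ∉ e})).Reachable b c ∧ ¬ (openGraph (ω ∩ {e | o ∉ e})).Reachable a b} := by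
    ext ω; simp only [Set.mem_setOf_eq]
    exact ⟨fun ⟨h1, h2⟩ => ⟨h1.symm, fun h => h2 ((h.trans h1.symm).symm)⟩,
      fun ⟨h1, h2⟩ => ⟨h1.symm, fun h => h2 (h.symm.trans h1.symm)⟩⟩
  have s5 : {ω : BondConfig (Fin n) | (openGraph (ω ∩ {e | o ∉ e})).Reachable c a ∧
      (openGraph (ω ∩ {e | o ∉ e})).Reachable c b} =
      {ω | (openGraph (ω ∩ {e | o ∉ e})).Reachable a b ∧ (openGraph (ω ∩ {e | o ∉ e})).Reachable a c} := by
    ext ω; simp only [Set.mem_setOf_eq]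
    exact ⟨fun ⟨h1, h2⟩ => ⟨h1.symm.trans h2, h1.symm⟩, fun ⟨h1, h2⟩ => ⟨h2.symm, h2.symm.trans h1⟩⟩
  rw [s1, s2, s3, s4, s5] at h
  linarith [h]

end GZ

/-! ### `Z(3,2)` at a three-port observer from a cell solver -/

/-- **`Z(3,2)` at a three-port observer, from any real-algebra cell solver.**  Let `o` be adjacent (with positive weight) only to `a, b, c`,
with hairs `α, β, γ`.  Suppose the real system in the five cell unknowns — cells `≥ 0` summing to `1`, the three failed exchanges
`U0·T_v + U_opp(v)·V_v < 0`, the three Gladkov–Zimin rows, and `Σ_v q_v > 2` in collected cell form — has no solution (`hsolve`).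
Then `Σ_v μ(o↔v) > 2` and `t ≥ μ(o↮v)` (`v = a,b,c`) give `μ{o reaches at most one of a,b,c} ≤ t`. [this work] -/
theorem le_one_reached_le_of_cellSolver (w : Sym2 (Fin n) → unitInterval) (R : Finset (Fin n)) (o a b c : Fin n) (t : ℝ)
    (hR : R = {a, b, c}) (hao : a ≠ o) (hbo : b ≠ o) (hco : c ≠ o) (hab : a ≠ b) (hac : a ≠ c) (hbc : b ≠ c)
    (hobs : ∀ u, u ≠ o → u ≠ a → u ≠ b → u ≠ c → w s(o, u) = 0)
    (hsolve : ∀ U0 Uab Uac Ubc U3 : ℝ, 0 ≤ U0 → 0 ≤ Uab → 0 ≤ Uac → 0 ≤ Ubc → 0 ≤ U3 →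
      Uab + Uac + Ubc + U3 + U0 = 1 →
      U0 * ((1 - (w s(o, a) : ℝ)) * w s(o, b) * w s(o, c) - w s(o, a) * (1 - w s(o, b)) * (1 - w s(o, c))) +
        Ubc * (w s(o, b) + w s(o, c) - w s(o, b) * w s(o, c) - w s(o, a)) < 0 →
      U0 * ((1 - (w s(o, b) : ℝ)) * w s(o, a) * w s(o, c) - w s(o, b) * (1 - w s(o, a)) * (1 - w s(o, c))) +
        Uac * (w s(o, a) + w s(o, c) - w s(o, a) * w s(o, c) - w s(o, b)) < 0 →
      U0 * ((1 - (w s(o, c) : ℝ)) * w s(o, a) * w s(o, b) - w s(o, c) * (1 - w s(o, a)) * (1 - w s(o, b))) +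
        Uab * (w s(o, a) + w s(o, b) - w s(o, a) * w s(o, b) - w s(o, c)) < 0 →
      (U0 + Ubc) * (Uab + Uac + U3) ≤ Uab + Uac + Ubc →
      (U0 + Uac) * (Uab + Ubc + U3) ≤ Uab + Uac + Ubc →
      (U0 + Uab) * (Uac + Ubc + U3) ≤ Uab + Uac + Ubc →
      2 < ((w s(o, a) : ℝ) + w s(o, b) + w s(o, c)) + (w s(o, a) + w s(o, b) - 2 * w s(o, a) * w s(o, b)) * Uab +
        (w s(o, a) + w s(o, c) - 2 * w s(o, a) * w s(o, c)) * Uac + (w s(o, b) + w s(o, c) - 2 * w s(o, b) * w s(o, c)) * Ubc +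
        ((1 - w s(o, a)) * (w s(o, b) + w s(o, c) - w s(o, b) * w s(o, c)) +
          (1 - w s(o, b)) * (w s(o, a) + w s(o, c) - w s(o, a) * w s(o, c)) +
          (1 - w s(o, c)) * (w s(o, a) + w s(o, b) - w s(o, a) * w s(o, b))) * U3 → False)
    (hsum : 2 < (prodBernoulli w).real (openConn o a) + (prodBernoulli w).real (openConn o b) +
      (prodBernoulli w).real (openConn o c))
    (hta : (prodBernoulli w).real (openConn o a)ᶜ ≤ t) (htb : (prodBernoulli w).real (openConn o b)ᶜ ≤ t)
    (htc : (prodBernoulli w).real (openConn o c)ᶜ ≤ t) :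
    (prodBernoulli w).real {ω : BondConfig (Fin n) | (R.filter fun v => ω ∈ openConn o v).card ≤ 1} ≤ t := by
  have ha : a ∈ R := (by simp [hR]); have hb : b ∈ R := (by simp [hR]); have hc : c ∈ R := by simp [hR]
  by_cases hA : (prodBernoulli w).real {ω | ω ∈ openConn o a ∧ ω ∉ openConn o b ∧ ω ∉ openConn o c} ≤
      (prodBernoulli w).real {ω | ω ∉ openConn o a ∧ ω ∈ openConn o b ∧ ω ∈ openConn o c}
  · exact (OneCutFive.measureReal_le_one_le_compl_of_exchange w R o a b c ha hb hc hab hac hbc hA).trans hta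
  by_cases hB : (prodBernoulli w).real {ω | ω ∈ openConn o b ∧ ω ∉ openConn o a ∧ ω ∉ openConn o c} ≤
      (prodBernoulli w).real {ω | ω ∉ openConn o b ∧ ω ∈ openConn o a ∧ ω ∈ openConn o c}
  · exact (OneCutFive.measureReal_le_one_le_compl_of_exchange w R o b a c hb ha hc hab.symm hbc hac hB).trans htb
  by_cases hC : (prodBernoulli w).real {ω | ω ∈ openConn o c ∧ ω ∉ openConn o a ∧ ω ∉ openConn o b} ≤
      (prodBernoulli w).real {ω | ω ∉ openConn o c ∧ ω ∈ openConn o a ∧ ω ∈ openConn o b}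
  · exact (OneCutFive.measureReal_le_one_le_compl_of_exchange w R o c a b hc ha hb hac.symm hbc.symm hab hC).trans htc
  exfalso
  push Not at hA hB hC
  have hobs' : ∀ u, u ≠ o → u ≠ b → u ≠ a → u ≠ c → w s(o, u) = 0 := fun u h1 h2 h3 h4 => hobs u h1 h3 h2 h4
  have hobs'' : ∀ u, u ≠ o → u ≠ c → u ≠ a → u ≠ b → w s(o, u) = 0 := fun u h1 h2 h3 h4 => hobs u h1 h3 h4 h2
  have hma := margin_eq w o a b c hao hbo hco hab hac hbc hobs
  have hmb := margin_eq w o b a c hbo hao hco hab.symm hbc hac hobs'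
  have hmc := margin_eq w o c a b hco hao hbo hac.symm hbc.symm hab hobs''
  have hqa := real_openConn w o a b c hao hbo hco hab hac hbc hobs
  have hqb := real_openConn_b w o a b c hao hbo hco hab hac hbc hobs
  have hqc := real_openConn_c w o a b c hao hbo hco hab hac hbc hobs
  have hcells := cells_sum_eq_one w o a b c
  have hGZa := gz_offObserver w o a b c
  have hGZb := gz_offObserver_apex_b w o a b c
  have hGZc := gz_offObserver_apex_c w o a b c
  have s1 : {ω : BondConfig (Fin n) | ¬ (openGraph (ω ∩ {e | o ∉ e})).Reachable b a ∧
      ¬ (openGraph (ω ∩ {e | o ∉ e})).Reachable b c ∧ ¬ (openGraph (ω ∩ {e | o ∉ e})).Reachable a c} =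
      {ω | ¬ (openGraph (ω ∩ {e | o ∉ e})).Reachable a b ∧
        ¬ (openGraph (ω ∩ {e | o ∉ e})).Reachable a c ∧ ¬ (openGraph (ω ∩ {e | o ∉ e})).Reachable b c} := by
    ext ω; simp only [Set.mem_setOf_eq]
    exact ⟨fun ⟨h1, h2, h3⟩ => ⟨fun h => h1 h.symm, h3, h2⟩, fun ⟨h1, h2, h3⟩ => ⟨fun h => h1 h.symm, h3, h2⟩⟩
  have s2 : {ω : BondConfig (Fin n) | (openGraph (ω ∩ {e | o ∉ e})).Reachable a c ∧
      ¬ (openGraph (ω ∩ {e | o ∉ e})).Reachable b a} =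
      {ω | (openGraph (ω ∩ {e | o ∉ e})).Reachable a c ∧ ¬ (openGraph (ω ∩ {e | o ∉ e})).Reachable a b} := by
    ext ω; simp only [Set.mem_setOf_eq]
    exact ⟨fun ⟨h1, h2⟩ => ⟨h1, fun h => h2 h.symm⟩, fun ⟨h1, h2⟩ => ⟨h1, fun h => h2 h.symm⟩⟩
  have s3 : {ω : BondConfig (Fin n) | ¬ (openGraph (ω ∩ {e | o ∉ e})).Reachable c a ∧
      ¬ (openGraph (ω ∩ {e | o ∉ e})).Reachable c b ∧ ¬ (openGraph (ω ∩ {e | o ∉ e})).Reachable a b} =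
      {ω | ¬ (openGraph (ω ∩ {e | o ∉ e})).Reachable a b ∧
        ¬ (openGraph (ω ∩ {e | o ∉ e})).Reachable a c ∧ ¬ (openGraph (ω ∩ {e | o ∉ e})).Reachable b c} := by
    ext ω; simp only [Set.mem_setOf_eq]
    exact ⟨fun ⟨h1, h2, h3⟩ => ⟨h3, fun h => h1 h.symm, fun h => h2 h.symm⟩,
      fun ⟨h1, h2, h3⟩ => ⟨fun h => h2 h.symm, fun h => h3 h.symm, h1⟩⟩
  have s4 : {ω : BondConfig (Fin n) | (openGraph (ω ∩ {e | o ∉ e})).Reachable a b ∧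
      ¬ (openGraph (ω ∩ {e | o ∉ e})).Reachable c a} =
      {ω | (openGraph (ω ∩ {e | o ∉ e})).Reachable a b ∧ ¬ (openGraph (ω ∩ {e | o ∉ e})).Reachable a c} := by
    ext ω; simp only [Set.mem_setOf_eq]
    exact ⟨fun ⟨h1, h2⟩ => ⟨h1, fun h => h2 h.symm⟩, fun ⟨h1, h2⟩ => ⟨h1, fun h => h2 h.symm⟩⟩
  rw [s1, s2] at hmb
  rw [s3, s4] at hmc
  rw [hqa, hqb, hqc, sigma_cells_collect] at hsum
  exact hsolve _ _ _ _ _ measureReal_nonneg measureReal_nonneg measureReal_nonneg measureReal_nonneg measureReal_nonneg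
    hcells (by linarith [hma, hA]) (by linarith [hmb, hB]) (by linarith [hmc, hC]) hGZa hGZb hGZc hsum

end ThreePort

end Summit.CriticalPhenomena.PercolationContinuityZ3.Theorems

end
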